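import Summits.ValiantsHypothesis.ValiantsHypothesis.Theorems.KPlusLogSqLawTridiagonalRealStaticPumpIterParity

/-!
# Route «KPlusLogSqLaw», crux `WeakLifting` (stmt-ValiantsHypothesis-19561) — REAL side of the tridiagonal sector:
# THE ANALYTIC PUMP, EVEN SIZES: a static definite tridiagonal `(2j+6) × (2j+6)` monomial matrix with `≥ 4j + 6 = 2(2j+6) − 6` positive zeros

HONEST FRAMING.  Helper (`--supports stmt-ValiantsHypothesis-19561 --as helper`), seat val-sym-lift-p1 (g12), cell `pub-symmetroid`,
2026-08-27, R2114 currency.  LOWER side only.  Refinement of `…Pump` (`B m ≥ 2m − 7`, all `m ≥ 5`) at the EVEN sizes, where val-sym-lift-p3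
g9's pump-and-harvest reaches `2m − 6` (the harvest meets the junction with a transition zero): after an odd number `k = 2j + 1` of pump moves
the orientation is `ρ = 1` (`pump_iter_parity`), so `pump_harvest_pos` yields `|R| + |T| + 4 = 2k + 5` alternation points, i.e.
`exists_static_definite_tridiagonal_pump_even (j)`: a static definite symmetric tridiagonal `(2j+6) × (2j+6)` monomial matrix with at least
`4j + 6 = 2(2j+6) − 6` distinct positive determinant zeros; `twice_sub_six_le_of_definiteRow_even`: every admissible law has
`4j + 6 ≤ B (2j + 6)`.  With `…Pump`: `B m ≥ 2m − 6` for even `m ≥ 6`, `B m ≥ 2m − 7` for odd `m ≥ 5` — exactly the located values of the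
hierarchical limit game (lift-p3 g9 memo §2/§3c), now kernel for all sizes.  Nothing here is an UPPER bound; nothing bears on `WeakLifting` /
`TropicalB` in their windows, Conjecture B, the doors, `MatrixDescartes` (stmt-18050) or VP ≠ VNP.  [mechanism: val-sym-lift-p3 g9's pump; folklore]
-/

-- `Summit.ValiantsHypothesis.ValiantsHypothesis.…` repeats a component by the D-0017 layout (single-conjunct summit); the name is mandated.
set_option linter.dupNamespace false
set_option autoImplicit false

namespace Summit.ValiantsHypothesis.ValiantsHypothesis.Theorems.KPlusLogSqLaw.StaticTridiagonalRealLadder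

open Polynomial
open Summit.ValiantsHypothesis.ValiantsHypothesis.Theorems.ValuativeFlip (ctK ctPath ctPath_apply ctK_zero ctK_one ctK_add_two)

/-- **HARVEST, orientation `ρ = 1`, WITH THE EXTRA POINT COUNTED** (verbatim `…PumpHarvestPos.pump_harvest_pos`, whose statement
only records `|R| + |T| + 3`; here `+ 4`): one edge of type II (`X^L` vertex, `√κ·X⁰` link)
switching between the junction `M` and a fresh point `M⁺` gives `D_{k+5}` with `|R| + |T| + 4` certified alternations along
`x₁ :: R ++ M :: M⁺ :: T ++ [y]`. [mechanism: val-sym-lift-p3 g9's harvest; folklore analysis] -/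
theorem pump_harvest_pos₄ (k : ℕ) {e : ℕ → ℕ} {b : ℕ → ℝ} {f : ℕ → ℕ} {s μ P0 x x₁ M y y₁ P1 : ℝ} {R T : List ℝ}
    (hs : μ = -s) (hP0 : 0 < P0)
    (c1 : (P0 :: x :: x₁ :: (R ++ M :: (T ++ [y, y₁, P1]))).IsChain (· < ·))
    (c2e : s * (fun z : ℝ => (((ctPath (fun t => (X : ℝ[X]) ^ e t) (fun t => C (b t) * X ^ f t) (fun t => C (b (t - 1)) * X ^ f (t - 1)) (k + 4))).det).eval (1 * z)) M < 0)
    (c2f : (M :: (T ++ [y])).IsChain (fun u v => (fun z : ℝ => (((ctPath (fun t => (X : ℝ[X]) ^ e t) (fun t => C (b t) * X ^ f t) (fun t => C (b (t - 1)) * X ^ f (t - 1)) (k + 4))).det).eval (1 * z)) u * (fun z : ℝ => (((ctPath (fun t => (X : ℝ[X]) ^ e t) (fun t => C (b t) * X ^ f t) (fun t => C (b (t - 1)) * X ^ f (t - 1)) (k + 4))).det).eval (1 * z)) v < 0))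
    (c2g : μ * (fun z : ℝ => (((ctPath (fun t => (X : ℝ[X]) ^ e t) (fun t => C (b t) * X ^ f t) (fun t => C (b (t - 1)) * X ^ f (t - 1)) (k + 4))).det).eval (1 * z)) y < 0)
    (c3c : s * (fun z : ℝ => (((ctPath (fun t => (X : ℝ[X]) ^ e t) (fun t => C (b t) * X ^ f t) (fun t => C (b (t - 1)) * X ^ f (t - 1)) (k + 3))).det).eval (1 * z)) x₁ < 0)
    (c3d : (x₁ :: (R ++ [M])).IsChain (fun u v => (fun z : ℝ => (((ctPath (fun t => (X : ℝ[X]) ^ e t) (fun t => C (b t) * X ^ f t) (fun t => C (b (t - 1)) * X ^ f (t - 1)) (k + 3))).det).eval (1 * z)) u * (fun z : ℝ => (((ctPath (fun t => (X : ℝ[X]) ^ e t) (fun t => C (b t) * X ^ f t) (fun t => C (b (t - 1)) * X ^ f (t - 1)) (k + 3))).det).eval (1 * z)) v < 0))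
    (c3e : 0 < μ * (fun z : ℝ => (((ctPath (fun t => (X : ℝ[X]) ^ e t) (fun t => C (b t) * X ^ f t) (fun t => C (b (t - 1)) * X ^ f (t - 1)) (k + 3))).det).eval (1 * z)) M)
    (c4 : (∀ z ∈ Set.Icc P0 x₁, s * (fun z : ℝ => (((ctPath (fun t => (X : ℝ[X]) ^ e t) (fun t => C (b t) * X ^ f t) (fun t => C (b (t - 1)) * X ^ f (t - 1)) (k + 3))).det).eval (1 * z)) z < 0))
    (c5 : (∀ z ∈ Set.Icc y P1, μ * (fun z : ℝ => (((ctPath (fun t => (X : ℝ[X]) ^ e t) (fun t => C (b t) * X ^ f t) (fun t => C (b (t - 1)) * X ^ f (t - 1)) (k + 4))).det).eval (1 * z)) z < 0)) :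
    ∃ (e' : ℕ → ℕ) (b' : ℕ → ℝ) (f' : ℕ → ℕ) (Λ : List ℝ),
      Λ.IsChain (· < ·) ∧ (∀ u ∈ Λ, 0 < u) ∧ R.length + T.length + 4 ≤ Λ.length ∧
      Λ.IsChain (fun u v => (((ctPath (fun t => (X : ℝ[X]) ^ e' t) (fun t => C (b' t) * X ^ f' t) (fun t => C (b' (t - 1)) * X ^ f' (t - 1)) (k + 5))).det).eval u * (((ctPath (fun t => (X : ℝ[X]) ^ e' t) (fun t => C (b' t) * X ^ f' t) (fun t => C (b' (t - 1)) * X ^ f' (t - 1)) (k + 5))).det).eval v < 0) := by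
  -- list surgery on the sample list
  have c1s : ((P0 :: x :: x₁ :: R) ++ M :: (T ++ [y, y₁, P1])).IsChain (· < ·) := c1
  have cleft : ((P0 :: x :: x₁ :: R) ++ [M]).IsChain (· < ·) := (List.isChain_split.mp c1s).1
  have cright : (M :: (T ++ [y, y₁, P1])).IsChain (· < ·) := (List.isChain_split.mp c1s).2
  have cleft' : (x₁ :: (R ++ [M])).IsChain (· < ·) :=
    (List.isChain_cons_cons.mp (List.isChain_cons_cons.mp cleft).2).2
  have hltM : ∀ u ∈ P0 :: x :: x₁ :: R, u < M := lt_last_of_isChain cleft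
  have cright' : ((M :: (T ++ [y])) ++ [y₁, P1]).IsChain (· < ·) := by simpa using cright
  have cMTy : (M :: (T ++ [y])).IsChain (· < ·) := cright'.left_of_append
  have hMlt : ∀ u ∈ T ++ [y, y₁, P1], M < u := fun u hu =>
    (List.pairwise_cons.mp (List.isChain_iff_pairwise.mp cright)).1 u hu
  have cyyP : (y :: [y₁, P1]).IsChain (· < ·) := (List.isChain_split.mp (List.isChain_cons.mp cright).2).2
  have hyy₁ : y < y₁ := (List.isChain_cons_cons.mp cyyP).1
  have hy₁P1 : y₁ < P1 := (List.isChain_cons_cons.mp (List.isChain_cons_cons.mp cyyP).2).1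
  have o1 : P0 < x := (List.isChain_cons_cons.mp c1).1
  have o2 : x < x₁ := (List.isChain_cons_cons.mp (List.isChain_cons_cons.mp c1).2).1
  have hleP1 := le_last_of_isChain c1
  -- non-vanishing facts
  have hGne : ∀ P ∈ M :: (T ++ [y, y₁, P1]), (fun z : ℝ => (((ctPath (fun t => (X : ℝ[X]) ^ e t) (fun t => C (b t) * X ^ f t) (fun t => C (b (t - 1)) * X ^ f (t - 1)) (k + 4))).det).eval (1 * z)) P ≠ 0 := by
    intro P hP
    simp only [List.mem_cons, List.mem_append, List.mem_nil_iff, or_false] at hP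
    rcases hP with hP | hP | hP | hP | hP
    · rw [hP]; intro h0; rw [h0, mul_zero] at c2e; exact lt_irrefl _ c2e
    · exact ne_zero_of_isChain_alt₂ c2f (by simp) P (by simp [hP])
    · rw [hP]; intro h0; rw [h0, mul_zero] at c2g; exact lt_irrefl _ c2g
    · rw [hP]; intro h0; have := c5 y₁ ⟨hyy₁.le, hy₁P1.le⟩; rw [h0, mul_zero] at this; exact lt_irrefl _ this
    · rw [hP]; intro h0; have := c5 P1 ⟨(hyy₁.trans hy₁P1).le, le_rfl⟩; rw [h0, mul_zero] at this; exact lt_irrefl _ this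
  have hFne : ∀ P ∈ P0 :: x :: x₁ :: (R ++ [M]), (fun z : ℝ => (((ctPath (fun t => (X : ℝ[X]) ^ e t) (fun t => C (b t) * X ^ f t) (fun t => C (b (t - 1)) * X ^ f (t - 1)) (k + 3))).det).eval (1 * z)) P ≠ 0 := by
    intro P hP
    simp only [List.mem_cons, List.mem_append, List.mem_nil_iff, or_false] at hP
    rcases hP with hP | hP | hP | hP | hP
    · rw [hP]; intro h0; have := c4 P0 ⟨le_rfl, (o1.trans o2).le⟩; rw [h0, mul_zero] at this; exact lt_irrefl _ this
    · rw [hP]; intro h0; have := c4 x ⟨o1.le, o2.le⟩; rw [h0, mul_zero] at this; exact lt_irrefl _ this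
    · rw [hP]; intro h0; rw [h0, mul_zero] at c3c; exact lt_irrefl _ c3c
    · exact ne_zero_of_isChain_alt₂ c3d (by simp) P (by simp [hP])
    · rw [hP]; intro h0; rw [h0, mul_zero] at c3e; exact lt_irrefl _ c3e
  have hFc := continuous_eval_det_epath e b f (k + 3) 1
  have hGc := continuous_eval_det_epath e b f (k + 4) 1
  obtain ⟨hd, hMhd, hhd⟩ := exists_head_le cright (by simp)
  obtain ⟨Mp, ⟨hMMp, hMphd⟩, hGMp, -⟩ := exists_point_right₂ hGc hFc (s := -s) (t := μ) hMhd (by linarith [c2e]) c3e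
  obtain ⟨L, κ', hκ', hl, hr⟩ := exists_move_signs_sep (fun z : ℝ => (((ctPath (fun t => (X : ℝ[X]) ^ e t) (fun t => C (b t) * X ^ f t) (fun t => C (b (t - 1)) * X ^ f (t - 1)) (k + 3))).det).eval (1 * z)) (fun z : ℝ => (((ctPath (fun t => (X : ℝ[X]) ^ e t) (fun t => C (b t) * X ^ f t) (fun t => C (b (t - 1)) * X ^ f (t - 1)) (k + 4))).det).eval (1 * z))
    (P0 :: x :: x₁ :: (R ++ [M])).toFinset (Mp :: (T ++ [y, y₁, P1])).toFinset ⟨P0, by simp⟩ ⟨Mp, by simp⟩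
    (fun a ha => by
      rw [List.mem_toFinset] at ha
      exact ⟨by linarith [head_le_of_isChain c1 a (mem_full_of_left ha)], hFne a ha⟩)
    (fun u hu => by
      rw [List.mem_toFinset, List.mem_cons] at hu
      rcases hu with hu | hu
      · rw [hu]; intro h0; rw [h0, mul_zero] at hGMp; exact lt_irrefl _ hGMp
      · exact hGne u (by simp only [List.mem_cons]; exact Or.inr hu))
    (fun a ha u hu => by
      rw [List.mem_toFinset] at ha hu
      have haM : a ≤ M := by
        have ha' : a ∈ (P0 :: x :: x₁ :: R) ++ [M] := by simpa using ha
        rcases List.mem_append.mp ha' with ha' | ha'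
        · exact (hltM a ha').le
        · rw [List.mem_singleton.mp ha']
      rcases List.mem_cons.mp hu with hu | hu
      · rw [hu]; linarith
      · linarith [hhd u hu])
  -- the harvested continuant
  obtain ⟨e', he'⟩ : ∃ e' : ℕ → ℕ, e' = fun t => if t < k + 4 then e t else L := ⟨_, rfl⟩
  obtain ⟨b', hb'⟩ : ∃ b' : ℕ → ℝ, b' = fun t => if t < k + 3 then b t else Real.sqrt (1 / κ') := ⟨_, rfl⟩
  obtain ⟨f', hf'⟩ : ∃ f' : ℕ → ℕ, f' = fun t => if t < k + 3 then f t else 0 := ⟨_, rfl⟩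
  have hagree : ∀ n, n ≤ k + 4 → (ctPath (fun t => (X : ℝ[X]) ^ e' t) (fun t => C (b' t) * X ^ f' t) (fun t => C (b' (t - 1)) * X ^ f' (t - 1)) n) = (ctPath (fun t => (X : ℝ[X]) ^ e t) (fun t => C (b t) * X ^ f t) (fun t => C (b (t - 1)) * X ^ f (t - 1)) n) := by
    intro n hn
    refine ctPath_congr_edata (fun t ht => ?_) (fun t ht => ?_) (fun t ht => ?_)
    · rw [he']; simp only [show t < k + 4 by omega, if_true]
    · rw [hb']; simp only [show t < k + 3 by omega, if_true]
    · rw [hf']; simp only [show t < k + 3 by omega, if_true]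
  have hD5 : ∀ u : ℝ, (((ctPath (fun t => (X : ℝ[X]) ^ e' t) (fun t => C (b' t) * X ^ f' t) (fun t => C (b' (t - 1)) * X ^ f' (t - 1)) (k + 5))).det).eval u =
      u ^ L * (((ctPath (fun t => (X : ℝ[X]) ^ e t) (fun t => C (b t) * X ^ f t) (fun t => C (b (t - 1)) * X ^ f (t - 1)) (k + 4))).det).eval u - 1 / κ' * (((ctPath (fun t => (X : ℝ[X]) ^ e t) (fun t => C (b t) * X ^ f t) (fun t => C (b (t - 1)) * X ^ f (t - 1)) (k + 3))).det).eval u := by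
    intro u
    have h := eval_det_epath_add_two e' b' f' (k + 3) u
    have h1 : e' (k + 3 + 1) = L := by rw [he']; simp
    have h2 : b' (k + 3) ^ 2 = 1 / κ' := by
      rw [hb']; simp only [lt_irrefl, if_false]; exact Real.sq_sqrt (by positivity)
    have h3 : f' (k + 3) = 0 := by rw [hf']; simp
    have h4 : (((ctPath (fun t => (X : ℝ[X]) ^ e' t) (fun t => C (b' t) * X ^ f' t) (fun t => C (b' (t - 1)) * X ^ f' (t - 1)) (k + 3 + 1))).det).eval u = (((ctPath (fun t => (X : ℝ[X]) ^ e t) (fun t => C (b t) * X ^ f t) (fun t => C (b (t - 1)) * X ^ f (t - 1)) (k + 4))).det).eval u := by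
      rw [hagree _ (by omega)]
    have h5 : (((ctPath (fun t => (X : ℝ[X]) ^ e' t) (fun t => C (b' t) * X ^ f' t) (fun t => C (b' (t - 1)) * X ^ f' (t - 1)) (k + 3))).det).eval u = (((ctPath (fun t => (X : ℝ[X]) ^ e t) (fun t => C (b t) * X ^ f t) (fun t => C (b (t - 1)) * X ^ f (t - 1)) (k + 3))).det).eval u := by
      rw [hagree _ (by omega)]
    rw [h1, h2, h3, h4, h5, mul_zero, pow_zero, mul_one] at h
    exact h
  -- signs of the harvested continuant: `−F` on the left block (incl. `M`), `G` from `M⁺` on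
  have sL : ∀ a ∈ P0 :: x :: x₁ :: (R ++ [M]), 0 < (-1) * ((fun z : ℝ => (((ctPath (fun t => (X : ℝ[X]) ^ e t) (fun t => C (b t) * X ^ f t) (fun t => C (b (t - 1)) * X ^ f (t - 1)) (k + 3))).det).eval (1 * z)) a * (((ctPath (fun t => (X : ℝ[X]) ^ e' t) (fun t => C (b' t) * X ^ f' t) (fun t => C (b' (t - 1)) * X ^ f' (t - 1)) (k + 5))).det).eval a) := by
    intro a ha
    have := hl a (List.mem_toFinset.mpr ha)
    rw [hD5]
    have e1 : (-1) * ((fun z : ℝ => (((ctPath (fun t => (X : ℝ[X]) ^ e t) (fun t => C (b t) * X ^ f t) (fun t => C (b (t - 1)) * X ^ f (t - 1)) (k + 3))).det).eval (1 * z)) a * (a ^ L * (((ctPath (fun t => (X : ℝ[X]) ^ e t) (fun t => C (b t) * X ^ f t) (fun t => C (b (t - 1)) * X ^ f (t - 1)) (k + 4))).det).eval a - 1 / κ' * (((ctPath (fun t => (X : ℝ[X]) ^ e t) (fun t => C (b t) * X ^ f t) (fun t => C (b (t - 1)) * X ^ f (t - 1)) (k + 3))).det).eval a)) =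
        (1 / κ') * (((((ctPath (fun t => (X : ℝ[X]) ^ e t) (fun t => C (b t) * X ^ f t) (fun t => C (b (t - 1)) * X ^ f (t - 1)) (k + 3))).det).eval (1 * a) - κ' * a ^ L * (((ctPath (fun t => (X : ℝ[X]) ^ e t) (fun t => C (b t) * X ^ f t) (fun t => C (b (t - 1)) * X ^ f (t - 1)) (k + 4))).det).eval (1 * a)) * (((ctPath (fun t => (X : ℝ[X]) ^ e t) (fun t => C (b t) * X ^ f t) (fun t => C (b (t - 1)) * X ^ f (t - 1)) (k + 3))).det).eval (1 * a)) := by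
      simp only [one_mul]; field_simp; ring
    rw [e1]; positivity
  have sR : ∀ u ∈ Mp :: (T ++ [y, y₁, P1]), 0 < 1 * ((fun z : ℝ => (((ctPath (fun t => (X : ℝ[X]) ^ e t) (fun t => C (b t) * X ^ f t) (fun t => C (b (t - 1)) * X ^ f (t - 1)) (k + 4))).det).eval (1 * z)) u * (((ctPath (fun t => (X : ℝ[X]) ^ e' t) (fun t => C (b' t) * X ^ f' t) (fun t => C (b' (t - 1)) * X ^ f' (t - 1)) (k + 5))).det).eval u) := by
    intro u hu
    have := hr u (List.mem_toFinset.mpr hu)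
    rw [hD5]
    have e1 : 1 * ((fun z : ℝ => (((ctPath (fun t => (X : ℝ[X]) ^ e t) (fun t => C (b t) * X ^ f t) (fun t => C (b (t - 1)) * X ^ f (t - 1)) (k + 4))).det).eval (1 * z)) u * (u ^ L * (((ctPath (fun t => (X : ℝ[X]) ^ e t) (fun t => C (b t) * X ^ f t) (fun t => C (b (t - 1)) * X ^ f (t - 1)) (k + 4))).det).eval u - 1 / κ' * (((ctPath (fun t => (X : ℝ[X]) ^ e t) (fun t => C (b t) * X ^ f t) (fun t => C (b (t - 1)) * X ^ f (t - 1)) (k + 3))).det).eval u)) =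
        (1 / κ') * -(((((ctPath (fun t => (X : ℝ[X]) ^ e t) (fun t => C (b t) * X ^ f t) (fun t => C (b (t - 1)) * X ^ f (t - 1)) (k + 3))).det).eval (1 * u) - κ' * u ^ L * (((ctPath (fun t => (X : ℝ[X]) ^ e t) (fun t => C (b t) * X ^ f t) (fun t => C (b (t - 1)) * X ^ f (t - 1)) (k + 4))).det).eval (1 * u)) * (((ctPath (fun t => (X : ℝ[X]) ^ e t) (fun t => C (b t) * X ^ f t) (fun t => C (b (t - 1)) * X ^ f (t - 1)) (k + 4))).det).eval (1 * u)) := by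
      simp only [one_mul]; field_simp; ring
    rw [e1]; positivity
  refine ⟨e', b', f', x₁ :: (R ++ M :: Mp :: (T ++ [y])), ?_, ?_, by simp; omega, ?_⟩
  · -- strictly increasing
    have e1 : x₁ :: (R ++ M :: Mp :: (T ++ [y])) = (x₁ :: R) ++ M :: Mp :: (T ++ [y]) := rfl
    rw [e1, List.isChain_split]
    refine ⟨cleft', List.isChain_cons_cons.mpr ⟨hMMp, List.isChain_iff_pairwise.mpr (List.pairwise_cons.mpr ⟨fun u hu => ?_, ?_⟩)⟩⟩
    · exact lt_of_lt_of_le hMphd (hhd u (by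
        rw [show T ++ [y, y₁, P1] = (T ++ [y]) ++ [y₁, P1] by simp]; exact List.mem_append_left _ hu))
    · exact List.isChain_iff_pairwise.mp (List.isChain_cons.mp cMTy).2
  · -- positive
    intro u hu
    have hx₁ : 0 < x₁ := hP0.trans (o1.trans o2)
    simp only [List.mem_cons, List.mem_append, List.mem_nil_iff, or_false] at hu
    rcases hu with hu | hu | hu | hu | hu | hu
    · rw [hu]; exact hx₁
    · linarith [head_le_of_isChain cleft' u (by simp [hu])]
    · rw [hu]; linarith [hltM x₁ (by simp)]
    · rw [hu]; linarith [hltM x₁ (by simp)]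
    · linarith [hMlt u (by simp [hu]), hltM x₁ (by simp)]
    · rw [hu]; linarith [hMlt y (by simp), hltM x₁ (by simp)]
  · -- alternation: `−F` alternates along `x₁ … M`, then the transition zero before `M⁺`, then `G` alternates along `M⁺ … y`
    have e1 : x₁ :: (R ++ M :: Mp :: (T ++ [y])) = (x₁ :: R) ++ M :: Mp :: (T ++ [y]) := rfl
    rw [e1, List.isChain_split]
    constructor
    · refine (isChain_alt_congr (c := -1) ?_).mp c3d
      intro a ha
      exact sL a (List.mem_cons_of_mem _ (List.mem_cons_of_mem _ ha))
    · have hFM : 0 < (-s) * (fun z : ℝ => (((ctPath (fun t => (X : ℝ[X]) ^ e t) (fun t => C (b t) * X ^ f t) (fun t => C (b (t - 1)) * X ^ f (t - 1)) (k + 3))).det).eval (1 * z)) M := by rw [← hs]; exact c3e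
      have h1 : (fun z : ℝ => (((ctPath (fun t => (X : ℝ[X]) ^ e t) (fun t => C (b t) * X ^ f t) (fun t => C (b (t - 1)) * X ^ f (t - 1)) (k + 3))).det).eval (1 * z)) M * (((ctPath (fun t => (X : ℝ[X]) ^ e' t) (fun t => C (b' t) * X ^ f' t) (fun t => C (b' (t - 1)) * X ^ f' (t - 1)) (k + 5))).det).eval M < 0 := by
        have := sL M (by simp); linarith
      have hφM : 0 < s * (((ctPath (fun t => (X : ℝ[X]) ^ e' t) (fun t => C (b' t) * X ^ f' t) (fun t => C (b' (t - 1)) * X ^ f' (t - 1)) (k + 5))).det).eval M := by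
        have := sgn_of_mul_neg (a := (((ctPath (fun t => (X : ℝ[X]) ^ e' t) (fun t => C (b' t) * X ^ f' t) (fun t => C (b' (t - 1)) * X ^ f' (t - 1)) (k + 5))).det).eval M) (b := (fun z : ℝ => (((ctPath (fun t => (X : ℝ[X]) ^ e t) (fun t => C (b t) * X ^ f t) (fun t => C (b (t - 1)) * X ^ f (t - 1)) (k + 3))).det).eval (1 * z)) M) (t := -s)
          (by linarith [mul_comm ((fun z : ℝ => (((ctPath (fun t => (X : ℝ[X]) ^ e t) (fun t => C (b t) * X ^ f t) (fun t => C (b (t - 1)) * X ^ f (t - 1)) (k + 3))).det).eval (1 * z)) M) ((((ctPath (fun t => (X : ℝ[X]) ^ e' t) (fun t => C (b' t) * X ^ f' t) (fun t => C (b' (t - 1)) * X ^ f' (t - 1)) (k + 5))).det).eval M)]) hFM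
        linarith
      have h2 : 0 < (fun z : ℝ => (((ctPath (fun t => (X : ℝ[X]) ^ e t) (fun t => C (b t) * X ^ f t) (fun t => C (b (t - 1)) * X ^ f (t - 1)) (k + 4))).det).eval (1 * z)) Mp * (((ctPath (fun t => (X : ℝ[X]) ^ e' t) (fun t => C (b' t) * X ^ f' t) (fun t => C (b' (t - 1)) * X ^ f' (t - 1)) (k + 5))).det).eval Mp := by
        have := sR Mp (by simp); linarith
      have hφMp : 0 < (-s) * (((ctPath (fun t => (X : ℝ[X]) ^ e' t) (fun t => C (b' t) * X ^ f' t) (fun t => C (b' (t - 1)) * X ^ f' (t - 1)) (k + 5))).det).eval Mp :=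
        sgn_of_mul_pos (a := (((ctPath (fun t => (X : ℝ[X]) ^ e' t) (fun t => C (b' t) * X ^ f' t) (fun t => C (b' (t - 1)) * X ^ f' (t - 1)) (k + 5))).det).eval Mp) (b := (fun z : ℝ => (((ctPath (fun t => (X : ℝ[X]) ^ e t) (fun t => C (b t) * X ^ f t) (fun t => C (b (t - 1)) * X ^ f (t - 1)) (k + 4))).det).eval (1 * z)) Mp)
          (by linarith [mul_comm ((fun z : ℝ => (((ctPath (fun t => (X : ℝ[X]) ^ e t) (fun t => C (b t) * X ^ f t) (fun t => C (b (t - 1)) * X ^ f (t - 1)) (k + 4))).det).eval (1 * z)) Mp) ((((ctPath (fun t => (X : ℝ[X]) ^ e' t) (fun t => C (b' t) * X ^ f' t) (fun t => C (b' (t - 1)) * X ^ f' (t - 1)) (k + 5))).det).eval Mp)]) hGMp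
      have hGG : 0 < (fun z : ℝ => (((ctPath (fun t => (X : ℝ[X]) ^ e t) (fun t => C (b t) * X ^ f t) (fun t => C (b (t - 1)) * X ^ f (t - 1)) (k + 4))).det).eval (1 * z)) M * (fun z : ℝ => (((ctPath (fun t => (X : ℝ[X]) ^ e t) (fun t => C (b t) * X ^ f t) (fun t => C (b (t - 1)) * X ^ f (t - 1)) (k + 4))).det).eval (1 * z)) Mp := mul_pos_of_sgn (t := -s) (by linarith [c2e]) hGMp
      refine List.isChain_cons_cons.mpr ⟨mul_neg_of_sgn (t := s) hφM (by linarith), ?_⟩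
      refine (isChain_alt_congr (c := 1) ?_).mp (isChain_alt_head c2f (M' := Mp) hGG)
      intro u hu
      exact sR u (mem_right_of_short hu)

/-- **HARVEST AFTER AN ODD NUMBER OF MOVES** (`k = 2j + 1`, orientation `ρ = 1`): data of a static definite tridiagonal `(2j+6) × (2j+6)` design
and a strictly increasing list of at least `4j + 7` positive points along which `D_{2j+6}` alternates. [val-sym-lift-p3 g9's harvest; folklore] -/
theorem pump_harvest_even (j : ℕ) : ∃ (e : ℕ → ℕ) (b : ℕ → ℝ) (f : ℕ → ℕ) (Λ : List ℝ),
    Λ.IsChain (· < ·) ∧ (∀ u ∈ Λ, 0 < u) ∧ 4 * j + 7 ≤ Λ.length ∧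
    Λ.IsChain (fun u v => (((ctPath (fun t => (X : ℝ[X]) ^ e t) (fun t => C (b t) * X ^ f t) (fun t => C (b (t - 1)) * X ^ f (t - 1)) (2 * j + 1 + 5))).det).eval u * (((ctPath (fun t => (X : ℝ[X]) ^ e t) (fun t => C (b t) * X ^ f t) (fun t => C (b (t - 1)) * X ^ f (t - 1)) (2 * j + 1 + 5))).det).eval v < 0) := by
  obtain ⟨e, b, f, ρ, s, μ, P0, x, x₁, R, M, T, y, y₁, P1, hρ, hμ, hρP0, hρP1, hlen,
    c1, -, -, -, -, c2e, c2f, c2g, c3c, c3d, c3e, -, -, -, -, c4, c5⟩ := pump_iter_parity (2 * j + 1)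
  have hρ1 : ρ = 1 := by
    rw [hρ, show 2 * j + 1 + 1 = 2 * (j + 1) by ring, pow_mul]; norm_num
  subst hρ1
  obtain ⟨e', b', f', Λ, h1, h2, h3, h4⟩ := pump_harvest_pos₄ (2 * j + 1) (by rw [hμ]; ring) (by linarith)
    c1 c2e c2f c2g c3c c3d c3e c4 c5
  exact ⟨e', b', f', Λ, h1, h2, by omega, h4⟩

/-- **THE ANALYTIC PUMP, EVEN SIZES**: for every `j` a STATIC DEFINITE symmetric tridiagonal `(2j+6) × (2j+6)` matrix of monomials
`c i j · X ^ (e i j)` (`c`, `e` symmetric, `c = 0` off the band, diagonal coefficients `1 > 0`) whose determinant has at least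
`4j + 6 = 2(2j+6) − 6` distinct positive zeros. [val-sym-lift-p3 g9's pump-and-harvest; folklore] -/
theorem exists_static_definite_tridiagonal_pump_even (j : ℕ) :
    ∃ (c : Fin (2 * j + 1 + 5) → Fin (2 * j + 1 + 5) → ℝ) (e : Fin (2 * j + 1 + 5) → Fin (2 * j + 1 + 5) → ℕ),
      (∀ i i', c i i' = c i' i) ∧ (∀ i i', e i i' = e i' i) ∧
      (∀ i i' : Fin (2 * j + 1 + 5), (i : ℕ) + 1 < i' ∨ (i' : ℕ) + 1 < i → c i i' = 0) ∧ (∀ i, 0 < c i i) ∧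
      4 * j + 6 ≤ ((Matrix.det (Matrix.of fun i i' => C (c i i') * (X : ℝ[X]) ^ e i i')).roots.toFinset.filter
        (fun t : ℝ => 0 < t)).card := by
  obtain ⟨ev, b, f, Λ, hincr, hpos, hlen, halt⟩ := pump_harvest_even j
  refine ⟨fun i i' => if (i' : ℕ) = i then 1 else if (i' : ℕ) = i + 1 then b i else if (i : ℕ) = i' + 1 then b i' else 0,
    fun i i' => if (i' : ℕ) = i then ev i else if (i' : ℕ) = i + 1 then f i else if (i : ℕ) = i' + 1 then f i' else 0,
    ?_, ?_, ?_, ?_, ?_⟩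
  · intro i i'
    dsimp only
    split_ifs <;> first | rfl | (exfalso; omega)
  · intro i i'
    dsimp only
    split_ifs <;> first | rfl | (exfalso; omega) | congr 1
  · intro i i' hii'
    dsimp only
    split_ifs <;> first | rfl | (exfalso; omega)
  · intro i; simp
  · have hM : (Matrix.of fun i i' : Fin (2 * j + 1 + 5) =>
        C ((if (i' : ℕ) = i then 1 else if (i' : ℕ) = i + 1 then b i else if (i : ℕ) = i' + 1 then b i' else 0 : ℝ)) *
          (X : ℝ[X]) ^ (if (i' : ℕ) = i then ev i else if (i' : ℕ) = i + 1 then f i else if (i : ℕ) = i' + 1 then f i' else 0 : ℕ)) =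
        (ctPath (fun t => (X : ℝ[X]) ^ ev t) (fun t => C (b t) * X ^ f t) (fun t => C (b (t - 1)) * X ^ f (t - 1)) (2 * j + 1 + 5)) := by
      ext i i'
      simp only [Matrix.of_apply, ctPath_apply]
      split_ifs with h1 h2 h3
      · simp
      · rfl
      · have : (i : ℕ) - 1 = i' := by omega
        rw [this]
      · simp
    rw [hM]
    have hcount := le_card_posRoots_of_isChain ((ctPath (fun t => (X : ℝ[X]) ^ ev t) (fun t => C (b t) * X ^ f t) (fun t => C (b (t - 1)) * X ^ f (t - 1)) (2 * j + 1 + 5))).det Λ hincr hpos halt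
    omega

/-- **Every admissible law on the sector has `4j + 6 ≤ B (2j + 6)` for all `j`**: `B m ≥ 2m − 6` at the even sizes `m ≥ 6`
(and `≥ 2m − 7` at the odd ones, `…Pump`). [corollary] -/
theorem twice_sub_six_le_of_definiteRow_even (B : ℕ → ℕ)
    (hB : ∀ (m : ℕ) (c : Fin m → Fin m → ℝ) (e : Fin m → Fin m → ℕ), (∀ i j, c i j = c j i) → (∀ i j, e i j = e j i) →
        (∀ i j : Fin m, (i : ℕ) + 1 < j ∨ (j : ℕ) + 1 < i → c i j = 0) → (∀ i, 0 < c i i) →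
        ((Matrix.det (Matrix.of fun i j => C (c i j) * (X : ℝ[X]) ^ e i j)).roots.toFinset.filter
          (fun t : ℝ => 0 < t)).card ≤ B m)
    (j : ℕ) : 4 * j + 6 ≤ B (2 * j + 6) := by
  obtain ⟨c, e, hc, he, hband, hpos, hcard⟩ := exists_static_definite_tridiagonal_pump_even j
  exact hcard.trans (hB _ c e hc he hband hpos)

end Summit.ValiantsHypothesis.ValiantsHypothesis.Theorems.KPlusLogSqLaw.StaticTridiagonalRealLadder
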